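import Summits.BirchSwinnertonDyer.BirchSwinnertonDyer.Theorems.EisensteinPrimesGoodLatticeQuotCharUnramified
import Literature.NumberTheory.GaloisRepresentations.ArtinCharacterReciprocityProofs
import Literature.NumberTheory.GaloisRepresentations.IntegralGaloisActionProofs
import HarnessLib

/-!
# Route `EisensteinPrimes` (rung K5), crux 2 `GoodLatticeBDPValue`, line `halves`, stub
# `stub_muLambda`: the HECKE CHARACTER of a Teichmüller character EXISTS — the class-field-theory
# half of the displayed input [F1], IN THE KERNEL (from the tree's Artin reciprocity theorem)

Cell `bsd-eis` (FULL-BSD rank-≤1 programme, `run/shared/lean/pub/bsd-eis/`), seat `bsd-eis-k5-c2`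
(D-0074 group (C) row A). In the kernel split of `stub_muLambda` (HOME/k5-c2-MEMO-1.md) the
displayed PUBLISHED input [F1] (`X1.KellerYinMuLambdaSplit.KatzFrameExistsFor`) has two halves:
(F1a) for a Teichmüller character `θ : Γ_K → GL₁(𝓞)` (`θ^{p−1} = 1`, `𝓞 = 𝓞_{ℚ_p(S)} ⊂ ℚ̄_p`)
and an identification `ι : ℚ̄_p ≃ ℂ`, there is a finite-order Hecke character `θ_K` of `K` attached
to `θ` by ARITHMETIC reciprocity — at every place `w` where `θ` is unramified, `θ_K` is unramified
and `θ_K(ϖ_w) = ι(θ(Frob_w^{arith}))` (the typer's `KellerYin2024.IsHeckeCharOf ι θ θ_K`, p421326,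
stated here UNFOLDED so that this file does not wait for that module) — and (F1b) the Katz
`p`-adic `L`-function of `θ_K` exists (Katz 1978 / Hida–Tilouine 1993 / Kriz 2016 Thm. 27; a
Literature fact). This file PROVES (F1a) from the tree's THEOREM `artinReciprocity_character_holds`
(Tate, Cassels–Fröhlich VII §5.1 (A) + §4.2, kernel-discharged in
`ArtinCharacterReciprocityProofs`):

* `exists_complexification_of_pow_eq_one` — the complexification `χ = ι ∘ θ : Γ_K → GL₁(ℂ)` of a
  Teichmüller character is a (continuous) rank-one Artin representation with entries
  `χ(σ)₀₀ = ι(θ(σ)₀₀)`. Continuity: `χ` is trivial on the open set `{σ : ‖θ(σ)₀₀ − 1‖ < 1}`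
  (Teichmüller rigidity `eq_one_of_pow_eq_one_of_norm_sub_one_lt_one`, p425660), so it is
  continuous at `1`, hence everywhere (`continuous_of_continuousAt_one`).
* `exists_heckeCharacter_of_pow_eq_one` — (F1a): `∃ θ_K` of finite order with, for every `w` at
  which `θ` is unramified, `θ_K` unramified at `w` and `θ_K(ϖ_w) = ι(a)` whenever
  `θ.HasFrobCharpolyAt w (X − C a)` (an arithmetic Frobenius above `w` exists:
  `exists_isArithFrobAt_of_mem_primesAbove_holds`, `primesAbove_nonempty`).

THEOREMS ONLY; no `def`, no named fact; nothing asserted about any curve; helper attached to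
stmt-BirchSwinnertonDyer-19032 (`--supports`, no stub credit). After p421326 lands, (F1a) reads
`∃ θK, θK.IsFiniteOrder ∧ KellerYin2024.IsHeckeCharOf ι θ θK` by `Iff.rfl`.

References: [CasselsFrohlichANT1967] Ch. VII §5.1 Main Theorem (A), §4.2 Corollary, §2.1;
[CastellaGrossiLeeSkinner2022] Thm. 2.1.2 (`θ_K`, "θ(p) = θ_K(ϖ_v)"); [KellerYin2024] §2.1.2
(arXiv:2402.12781v2 TeX L1407–1416); HOME/k5-c2-MEMO-1.md §1 S6, §3 F1.
-/

set_option autoImplicit false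
set_option linter.dupNamespace false

noncomputable section

open scoped Classical

open Polynomial NumberField IsDedekindDomain Field
  Literature.NumberTheory.EllipticCurves Literature.NumberTheory.GaloisRepresentations
  Literature.NumberTheory.EllipticCurves.KellerYin2024

namespace Summit.BirchSwinnertonDyer.BirchSwinnertonDyer.Theorems.EisensteinPrimesMuLambda

section Complexification

variable {K : Type} [Field K] {p : ℕ} [hp : Fact p.Prime] (S : Set (PadicAlgCl p))
  (ι : PadicAlgCl p ≃+* ℂ)

/-- `entry θ 1 = 1`, and more generally `θ σ = 1 ⟹ entry θ σ = 1`. [folklore] -/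
theorem entry_eq_one_of_apply_eq_one (θ : FramedGaloisRep K (padicCoeffIntegers S) 1)
    {σ : absoluteGaloisGroup K} (h : θ σ = 1) : entry S θ σ = 1 := by
  change (((θ σ : GL (Fin 1) (padicCoeffIntegers S)) :
    Matrix (Fin 1) (Fin 1) (padicCoeffIntegers S)) 0 0) = 1
  rw [h, Units.val_one, Matrix.one_apply_eq]

/-- The entry map `σ ↦ θ(σ)₀₀ ∈ ℚ̄_p` of a framed rank-one representation is continuous. [folklore] -/
theorem continuous_coe_entry (θ : FramedGaloisRep K (padicCoeffIntegers S) 1) :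
    Continuous fun σ : absoluteGaloisGroup K ↦ ((entry S θ σ : padicCoeffIntegers S) : PadicAlgCl p) := by
  have h1 : Continuous fun σ : absoluteGaloisGroup K ↦
      ((θ σ : GL (Fin 1) (padicCoeffIntegers S)) : Matrix (Fin 1) (Fin 1) (padicCoeffIntegers S)) :=
    Units.continuous_val.comp θ.continuous_toFun
  have h2 : Continuous fun σ : absoluteGaloisGroup K ↦ entry S θ σ :=
    ((continuous_apply 0).comp ((continuous_apply 0).comp h1))
  exact continuous_subtype_val.comp h2

/-- **The complexification of a Teichmüller character is a rank-one Artin representation.** For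
`θ : Γ_K → GL₁(𝓞)` with `θ^{p−1} = 1` and `ι : ℚ̄_p ≃ ℂ` there is a continuous
`χ : Γ_K → GL₁(ℂ)` with `χ(σ)₀₀ = ι(θ(σ)₀₀)` (continuity: `χ` is trivial on the open neighbourhood
`{σ : ‖θ(σ)₀₀ − 1‖ < 1}` of `1` by Teichmüller rigidity). [folklore] -/
theorem exists_complexification_of_pow_eq_one (θ : FramedGaloisRep K (padicCoeffIntegers S) 1)
    (hθ : ∀ σ : absoluteGaloisGroup K, θ σ ^ (p - 1) = 1) :
    ∃ χ : FramedGaloisRep K ℂ 1, ∀ σ : absoluteGaloisGroup K,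
      (((χ σ : GL (Fin 1) ℂ) : Matrix (Fin 1) (Fin 1) ℂ) 0 0) =
        ι ((entry S θ σ : padicCoeffIntegers S) : PadicAlgCl p) := by
  -- the bare character `χ₀ = ι ∘ det ∘ θ : Γ_K →* ℂˣ`
  let χ₀ : absoluteGaloisGroup K →* ℂˣ :=
    (Units.map (ι : PadicAlgCl p →* ℂ)).comp
      ((Units.map ((padicCoeffIntegers S).subtype : padicCoeffIntegers S →* PadicAlgCl p)).comp
        ((Matrix.GeneralLinearGroup.det :
            GL (Fin 1) (padicCoeffIntegers S) →* (padicCoeffIntegers S)ˣ).comp θ.toMonoidHom))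
  have hχ₀ : ∀ σ, ((χ₀ σ : ℂˣ) : ℂ) = ι ((entry S θ σ : padicCoeffIntegers S) : PadicAlgCl p) := by
    intro σ
    rw [entry_eq_det]
    rfl
  -- `χ₀` is trivial on the open set `U = {σ : ‖θ(σ)₀₀ - 1‖ < 1}`
  have hU : IsOpen {σ : absoluteGaloisGroup K |
      ‖((entry S θ σ : padicCoeffIntegers S) : PadicAlgCl p) - 1‖ < 1} :=
    isOpen_lt ((continuous_coe_entry S θ).sub continuous_const).norm continuous_const
  have htriv : ∀ σ : absoluteGaloisGroup K,
      ‖((entry S θ σ : padicCoeffIntegers S) : PadicAlgCl p) - 1‖ < 1 → χ₀ σ = 1 := by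
    intro σ hσ
    have hpow : ((entry S θ σ : padicCoeffIntegers S) : PadicAlgCl p) ^ (p - 1) = 1 := by
      have h := congrArg ((↑) : padicCoeffIntegers S → PadicAlgCl p)
        (entry_pow_eq_one_of_pow_eq_one S θ σ (hθ σ))
      push_cast at h
      exact h
    have hone := eq_one_of_pow_eq_one_of_norm_sub_one_lt_one hpow hσ
    apply Units.ext
    rw [hχ₀ σ, hone, map_one, Units.val_one]
  -- continuity at `1`, hence everywhere
  have hcont : Continuous χ₀ := by
    apply continuous_of_continuousAt_one
    rw [ContinuousAt, map_one]
    intro A hA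
    refine Filter.mem_map.mpr (Filter.mem_of_superset (hU.mem_nhds ?_) fun σ hσ ↦ ?_)
    · change ‖((entry S θ 1 : padicCoeffIntegers S) : PadicAlgCl p) - 1‖ < 1
      rw [entry_eq_one_of_apply_eq_one S θ (map_one θ), OneMemClass.coe_one, sub_self, norm_zero]
      exact one_pos
    · rw [Set.mem_preimage, htriv σ hσ]
      exact mem_of_mem_nhds hA
  refine ⟨(FramedRep.unitsContinuousMulEquivOfUnique (Fin 1) ℂ : ℂˣ →ₜ* GL (Fin 1) ℂ).comp
    ⟨χ₀, hcont⟩, fun σ ↦ ?_⟩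
  rw [← hχ₀ σ]
  rfl

end Complexification

section Hecke

variable {K : Type} [Field K] [NumberField K] {p : ℕ} [hp : Fact p.Prime]
  (S : Set (PadicAlgCl p)) (ι : PadicAlgCl p ≃+* ℂ)

/-- **(F1a) The Hecke character of a Teichmüller character EXISTS (arithmetic reciprocity).** For a
number field `K`, `θ : Γ_K → GL₁(𝓞)` with `θ^{p−1} = 1` (`𝓞 = 𝓞_{ℚ_p(S)} ⊂ ℚ̄_p`) and
`ι : ℚ̄_p ≃ ℂ`, there is a Hecke character `θ_K` of `K` OF FINITE ORDER such that at every finite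
place `w` where `θ` is unramified, `θ_K` is unramified and `θ_K(ϖ_w) = ι(a)` for every `a` with
`θ.HasFrobCharpolyAt w (X − C a)` (i.e. `θ_K(ϖ_w) = ι(θ(Frob_w^{arith}))`; = the typer's
`KellerYin2024.IsHeckeCharOf ι θ θ_K`, unfolded). From the tree's theorem
`artinReciprocity_character_holds` applied to the complexification `ι ∘ θ`, and the existence of an
arithmetic Frobenius above `w` (`exists_isArithFrobAt_of_mem_primesAbove_holds`). This is CGLS's
"`θ_K`" with "`θ(p) = θ_K(ϖ_v)`". [cite: CasselsFrohlichANT1967, Ch. VII §5.1 Main Theorem (A), §4.2 Corollary, §2.1]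
[cite: CastellaGrossiLeeSkinner2022, Thm. 2.1.2 (θ_K; arXiv:2008.02571v2 TeX L1015–1032)] -/
theorem exists_heckeCharacter_of_pow_eq_one (θ : FramedGaloisRep K (padicCoeffIntegers S) 1)
    (hθ : ∀ σ : absoluteGaloisGroup K, θ σ ^ (p - 1) = 1) :
    ∃ θK : HeckeCharacter K, θK.IsFiniteOrder ∧
      ∀ w : HeightOneSpectrum (𝓞 K), θ.IsUnramifiedAt w →
        θK.IsUnramifiedAt w ∧
          ∀ a : padicCoeffIntegers S, θ.HasFrobCharpolyAt w (X - C a) →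
            θK.valueAtUniformizer w = ι (a : PadicAlgCl p) := by
  obtain ⟨χ, hχ⟩ := exists_complexification_of_pow_eq_one S ι θ hθ
  obtain ⟨ω, hfin, hω⟩ := artinReciprocity_character_holds K χ
  refine ⟨ω, hfin, fun w hw ↦ ?_⟩
  -- `χ` is unramified where `θ` is
  have hχw : χ.IsUnramifiedAt w := by
    intro 𝔓 h𝔓 σ hσ
    have h1 : θ σ = 1 := hw 𝔓 h𝔓 σ hσ
    refine Matrix.GeneralLinearGroup.ext fun i j ↦ ?_
    rw [Subsingleton.elim i 0, Subsingleton.elim j 0, Units.val_one, Matrix.one_apply_eq, hχ σ,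
      entry_eq_one_of_apply_eq_one S θ h1, OneMemClass.coe_one, map_one]
  obtain ⟨hωw, hfrob⟩ := hω w hχw
  refine ⟨hωw, fun a ha ↦ ?_⟩
  -- read both Frobenius conditions at one arithmetic Frobenius above `w`
  rw [FramedGaloisRep.hasFrobCharpolyAt_iff_of_rank_one] at ha hfrob
  obtain ⟨𝔓, h𝔓⟩ := w.primesAbove_nonempty
  obtain ⟨Φ, hΦ⟩ := IsDedekindDomain.HeightOneSpectrum.exists_isArithFrobAt_of_mem_primesAbove_holds (K := K) (v := w) h𝔓
  have h1 : entry S θ Φ = a := ha 𝔓 h𝔓 Φ hΦ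
  have h2 := hfrob 𝔓 h𝔓 Φ hΦ
  rw [hχ Φ, h1] at h2
  exact h2.symm

end Hecke

end Summit.BirchSwinnertonDyer.BirchSwinnertonDyer.Theorems.EisensteinPrimesMuLambda

end
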